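import Literature.IUT.HodgeArakelov.MonoThetaFromGroupsProp13Genuine
import Literature.IUT.HodgeArakelov.ModelReconstructionInvariance
import Literature.AnabelianGeometry.EtaleTheta.Discharge.Sec5Lem59vTransport

/-!
# [IUTchII] Proposition 1.3 (iii) at the GENUINE `M^Θ(𝒞) = E^Π_N`: `(*mono-Θ)` IS [EtTh] Prop. 5.5's `ρ_{B_N}`

S. Mochizuki, *Inter-universal Teichmüller theory II*, §1, Proposition 1.3 (i)/(iii), kurims manuscript (Dec. 2020)
pp. 26–27 [claim: Mochizuki2012, status: disputed] (IUTchII §1 Prop 1.3 (iii), kurims pp.26-27): "(i) … the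
cyclotomic rigidity isomorphism of Definition 1.1, (ii), takes the form of an isomorphism `(l·Δ_Θ)_S ⊗ (ℤ/Nℤ) ⥲ μ_N(S)`
`(*mono-Θ)` [cf. [EtTh], Proposition 5.5; [EtTh], Lemma 5.9, (v)] … (iii) The cyclotomic rigidity isomorphisms
`(*mono-Θ)`, `(*bs-Gal)` … coincide."  abc-iut cell, DAG node `IUTchII:Prop1.3(iii)` (cone of [IUTchIII] Cor. 3.12,
LC-L2-1), discharge seat abc-iut-w4-d042 (gen 2).  PROOF-ONLY companion (no `def`, no new named fact) closing the
loop between this seat's three files: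

* `MonoThetaFromGroupsProp13Proofs.lean` (p411824): Prop. 1.3 (iii) ⟺ ONE residual equation "`(*bs-Gal)` read in
  `𝒞`'s cyclotomes `= ρ_{B_N}`" (plan/GAP-LEDGER G-w4d042-1) MODULO [EtTh] Lemma 5.9 (v) for the slot
  `a⁻¹ ≫ (*mono-Θ) ≫ b` (hypothesis `h59v` = abc-iut-L2-t4's `CycRigidityCoincide`);
* `MonoThetaFromGroupsProp13Genuine.lean` (p416299): the Prop. 1.2 (ii) output `M^Θ(𝒞) = E^Π_N` read through the
  bi-theta isomorphism `i` of [EtTh] Lemma 5.9 (iv), with the CANONICAL exterior correspondence `corrExtOfBiTheta`;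
* `EtaleTheta/Discharge/Sec5Lem59vTransport.lean` (p417589): [EtTh] Lemma 5.9 (v) ELEMENTWISE — under `i`, Prop. 5.5's
  `ρ_{B_N}` (abc-iut-L2-t4's `IsKummerDetermined`) IS the §2 identification `μ ∘ θ-mod` on `l·Δ_Θ`.

PROVED here, for the genuine output `E := EnvOfFrobenioid.ofBiTheta …` with ITS Def. 1.1 (ii) cyclotomic rigidity
isomorphism `C₀ := ModelFrame.cyclotomicRigidity` (bridge B8 part 5b, abc-iut-L6-d6; `(l·Δ_Θ)(M) ⊗ ℤ/Nℤ ⥲ Π_μ(M)`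
induced by `θ-mod`, read through `i`) and for ANY Frobenioid-cyclotome data `Z : FrobenioidCyclotomes E` of
Prop. 1.3 (i) whose correspondences, read in `𝒞`'s cyclotomes through identifications `a`, `b`, are the canonical
exterior one (`hb`) and an interior one compatible with the theta pre-subgroup projection of abc-iut-L2-t4's
`ThetaSubquotientProj` (`ha` — the shape the §2 ↔ §5 identification `ψ` of `(l·Δ_Θ)` must have; `ψ` itself is
NOT constructed here, cf. abc-iut-L2-lead 02:02:06Z / L2 MERGE-PLAN row 10):

* `ofBiTheta_cyclotomicRigidity_apply` — the genuine `(*mono-Θ)`'s `Π_M`-leg: under `i`, `C₀[g] = μ(θ-mod g)`;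
* **`monoTheta_read_eq_rigidity_ofBiTheta`** — `b((*mono-Θ)(a⁻¹[proj(ρ y)])) = ρ_{B_N}[proj(ρ y)]` for every
  `y ∈ Π^tp_Ÿ̲` with `ι y ∈ l·Δ_Θ` and `ρ y` in the theta pre-subgroup: "`(*mono-Θ)` [cf. [EtTh], Proposition 5.5;
  [EtTh], Lemma 5.9, (v)]" — the bracket of Prop. 1.3 (i) as a kernel theorem at the genuine object;
* **`cycRigidityCoincide_monoTheta_ofBiTheta`** — hence the `h59v` slot of p411824 is DISCHARGED at the genuine
  object (given coverage `hcov` of `(l·Δ_Θ)_{B_N} ⊗ ℤ/Nℤ` by such `y`);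
* **`prop13_iii_ofBiTheta_iff`** — **Prop. 1.3 (iii) at the genuine `M^Θ(𝒞)` is EQUIVALENT to the single equation
  "`(*bs-Gal)` read in `𝒞`'s cyclotomes `= ρ_{B_N}`" (G-w4d042-1)** with NO [EtTh] hypothesis left beyond the bi-theta
  isomorphism of Lemma 5.9 (iv) (`i`, `hi`, `hYdd`), Prop. 5.5 BY NAME (`IsKummerDetermined`), Cor. 2.18 (ii)/(iv) (in
  `E`'s construction) and the readings `ha`/`hb`/`hcov`; `prop13_iii_ofBiTheta_of_bsGal` the closing direction.

HONEST FRAMING: kernel-checked bookkeeping between typed statements ([EtTh] refereed; [IUTchII] record-only, claim key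
`Mochizuki2012`, D-0012, disputed); the [AbsTopIII] side of (iii) (G-w4d042-1; [AbsTopIII] Cor. 1.10 FACT-policy) is
untouched; nothing here bears on [IUTchIII] Cor. 3.12 and no side is taken; typed ≠ proved elsewhere.
-/

noncomputable section

namespace Literature.IUT.HodgeArakelov

universe w u

open CategoryTheory Literature.AnabelianGeometry.EtaleTheta
open scoped Literature.AnabelianGeometry.EtaleTheta

section GenuineCoincide

variable {S : ThetaSetting.{u}} {l : ℕ} {R : RigidData.{u} S.N l}
variable {C : Type (u + 1)} [Category.{u} C] {D : Type (u + 1)} [Category.{u} D]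
  (𝔉 : ThetaFrobenioid.{w} C D) (h1 : 𝔉.SectionsFactor) (h3 : 𝔉.OuterActionLZ)
  (hsec : 𝔉.SgpCapSection) (hcs : 𝔉.SgpCupSection) (h8 : 𝔉.ConstantsEqNormalizer)
  (DK : Set (TopOut 𝔉.EPiN))
  (h218ii : R.toThetaEnvData.Cor218_ii) (A : ModelAgreement S R.toThetaEnvData)
  {η : R.PiYdd → R.mu} (hη : η ∈ R.thetaCocycles)
  (i : (𝔉.frdBiThetaEnv h1 h3 hsec hcs h8 DK).Iso (R.toThetaEnvData.modelBi hη))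
  (F : ModelFrame S R) (Fr : TemperedFrobenioidData S)

/-- **The genuine `(*mono-Θ)`'s `Π_M`-leg**: the Def. 1.1 (ii) cyclotomic rigidity isomorphism of `M^Θ(𝒞) = E^Π_N`
(bridge B8's `ModelFrame.cyclotomicRigidity` read through the bi-theta isomorphism `i`), applied to the class of
`g ∈ l·Δ_Θ` and carried back into `Π^tp_Y[μ_N]` by `i`, is `μ(θ-mod g)` — the §2 identification of [EtTh] Cor. 2.19 (i)
(abc-iut-L6-d6's `coe_cyclotomicRigidity_apply` + `intModEquiv_mk_symm_mk`).
[claim: Mochizuki2012, status: disputed] (IUTchII §1 Def 1.1 (ii), kurims p.21) -/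
theorem ofBiTheta_cyclotomicRigidity_apply (g : R.lDeltaTheta) :
    i.e (((F.cyclotomicRigidity (isoModelOfBiTheta 𝔉 h1 h3 hsec hcs h8 DK h218ii A hη i).e).iso
        (((ModelCyclotomes.intCycEquiv R).symm (g : ModelCyclotomes.lDeltaQuot R) :
          (ModelCyclotomes.intCyc R).carrier) : ModPow (ModelCyclotomes.intCyc R).carrier (S.N : ℕ)) :
        (envOfBiTheta 𝔉 h1 h3 hsec hcs h8 DK h218ii A hη i).Pi)) =
      CycEnvelope.inMu R.augY R.chi (R.thetaMod g) := by
  rw [ModelFrame.coe_cyclotomicRigidity_apply, ModelCyclotomes.intModEquiv_mk_symm_mk]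
  exact i.e.apply_symm_apply _

/-- **`(*mono-Θ)` of the genuine `M^Θ(𝒞)` IS [EtTh] Prop. 5.5's `ρ_{B_N}`, elementwise** ("the cyclotomic rigidity
isomorphism of Definition 1.1, (ii), takes the form of an isomorphism `(l·Δ_Θ)_S ⊗ (ℤ/Nℤ) ⥲ μ_N(S)` (*mono-Θ) [cf. [EtTh],
Proposition 5.5; [EtTh], Lemma 5.9, (v)]", kurims p. 26): for Frobenioid-cyclotome data `Z` of Prop. 1.3 (i) over the
genuine output whose exterior correspondence read through `b` is the canonical one (`hb`) and whose interior
correspondence read through `a` is compatible with the theta pre-subgroup projection (`ha`), and for every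
`y ∈ Π^tp_Ÿ̲` with `ι y ∈ l·Δ_Θ` and `ρ y` in the theta pre-subgroup: `b((*mono-Θ)(a⁻¹[proj(ρ y)])) = ρ_{B_N}[proj(ρ y)]`.
Inputs BY NAME: the bi-theta isomorphism of Lemma 5.9 (iv) (`i`, `hi`, `hYdd`), Prop. 5.5 (`IsKummerDetermined`).
[claim: Mochizuki2012, status: disputed] (IUTchII §1 Prop 1.3 (i), kurims p.26) -/
theorem monoTheta_read_eq_rigidity_ofBiTheta (ι : 𝔉.PiX ≃ₜ* R.PiX)
    (hi : ∀ x : 𝔉.EPiN, ((CycEnvelope.proj R.augY R.chi (i.e x) : R.PiY) : R.PiX) = ι (𝔉.toPiY x))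
    (hYdd : 𝔉.PiYdd.map ι.toMonoidHom = R.PiYdd)
    (P : FrobenioidCyclotomicRigidity.ThetaSubquotientProj 𝔉) (ρ : FrobenioidCyclotomicRigidity.RigidityFamily 𝔉)
    (hB : 𝔉.IsThetaSaturated 𝔉.BN) (hρ : FrobenioidCyclotomicRigidity.IsKummerDetermined 𝔉 P ρ hB)
    (Z : FrobenioidCyclotomes (EnvOfFrobenioid.ofBiTheta 𝔉 h1 h3 hsec hcs h8 DK h218ii A hη i F Fr))
    (a : Z.intS.carrier ≃* 𝔉.lDeltaModN 𝔉.BN) (b : Z.muN ≃* 𝔉.muTorsion 𝔉.BN 𝔉.N)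
    (hb : ∀ x, b (Z.corrExt x) = corrExtOfBiTheta 𝔉 h1 h3 hsec hcs h8 DK h218ii A hη i F Fr ι hi x)
    (ha : ∀ (y : 𝔉.PiYdd) (hy : ι (y : 𝔉.PiX) ∈ R.lDeltaTheta)
      (hh : ((𝔉.rhoYdd y : 𝔉.HB) : Aut (𝔉.base.obj 𝔉.BN)) ∈ P.pre (𝔉.base.obj 𝔉.BN)),
      a (Z.corrInt (((ModelCyclotomes.intCycEquiv R).symm
        ((⟨ι (y : 𝔉.PiX), hy⟩ : R.lDeltaTheta) : ModelCyclotomes.lDeltaQuot R) :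
          (ModelCyclotomes.intCyc R).carrier) : ModPow (ModelCyclotomes.intCyc R).carrier (S.N : ℕ))) =
        (QuotientGroup.mk (P.proj _ ⟨_, hh⟩) : 𝔉.lDeltaModN 𝔉.BN))
    (y : 𝔉.PiYdd) (hy : ι (y : 𝔉.PiX) ∈ R.lDeltaTheta)
    (hh : ((𝔉.rhoYdd y : 𝔉.HB) : Aut (𝔉.base.obj 𝔉.BN)) ∈ P.pre (𝔉.base.obj 𝔉.BN)) :
    b (Z.monoTheta (F.cyclotomicRigidity (isoModelOfBiTheta 𝔉 h1 h3 hsec hcs h8 DK h218ii A hη i).e)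
        (a.symm (QuotientGroup.mk (P.proj _ ⟨_, hh⟩)))) =
      ρ 𝔉.BN hB (QuotientGroup.mk (P.proj _ ⟨_, hh⟩)) := by
  -- `a⁻¹[proj(ρ y)]` is `Z.corrInt` of the class of `ι y`
  have hax : a.symm (QuotientGroup.mk (P.proj _ ⟨_, hh⟩)) =
      Z.corrInt (((ModelCyclotomes.intCycEquiv R).symm
        ((⟨ι (y : 𝔉.PiX), hy⟩ : R.lDeltaTheta) : ModelCyclotomes.lDeltaQuot R) :
          (ModelCyclotomes.intCyc R).carrier) : ModPow (ModelCyclotomes.intCyc R).carrier (S.N : ℕ)) := by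
    rw [← ha y hy hh, MulEquiv.symm_apply_apply]
  rw [hax]
  unfold FrobenioidCyclotomes.monoTheta
  rw [MulEquiv.trans_apply, MulEquiv.trans_apply, MulEquiv.symm_apply_apply, hb]
  -- compare in `Π^tp_Y[μ_N]` through `μ_N(B_N) ↪ E^Π_N` and `i`
  have hinj : Function.Injective 𝔉.muIncl := muIncl_injective 𝔉
  apply hinj
  apply i.e.injective
  rw [muIncl_corrExtOfBiTheta,
    𝔉.biThetaIso_muIncl_rigidity_eq_thetaMod h1 h3 hsec hcs h8 DK R ι hη i hi hYdd P ρ hB hρ y hy hh]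
  exact ofBiTheta_cyclotomicRigidity_apply 𝔉 h1 h3 hsec hcs h8 DK h218ii A hη i F ⟨ι (y : 𝔉.PiX), hy⟩

/-- **The [EtTh] Lemma 5.9 (v) slot of p411824 DISCHARGED at the genuine `M^Θ(𝒞)`**: with coverage of
`(l·Δ_Θ)_{B_N} ⊗ ℤ/Nℤ` by classes `[proj(ρ y)]` (`hcov`), abc-iut-L2-t4's `CycRigidityCoincide` holds for the slot
`a⁻¹ ≫ (*mono-Θ) ≫ b` of the GENUINE `(*mono-Θ)` — the hypothesis `h59v` of `prop13_iii_of_cycRigidityCoincide` /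
`prop13_iii_iff_bsGal_read_eq_rho` is a THEOREM here. [cite: MochizukiEtTh2009, Lem 5.9 (v) p.332 (PDF p.106)] -/
theorem cycRigidityCoincide_monoTheta_ofBiTheta (ι : 𝔉.PiX ≃ₜ* R.PiX)
    (hi : ∀ x : 𝔉.EPiN, ((CycEnvelope.proj R.augY R.chi (i.e x) : R.PiY) : R.PiX) = ι (𝔉.toPiY x))
    (hYdd : 𝔉.PiYdd.map ι.toMonoidHom = R.PiYdd)
    (P : FrobenioidCyclotomicRigidity.ThetaSubquotientProj 𝔉) (ρ : FrobenioidCyclotomicRigidity.RigidityFamily 𝔉)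
    (hB : 𝔉.IsThetaSaturated 𝔉.BN) (hρ : FrobenioidCyclotomicRigidity.IsKummerDetermined 𝔉 P ρ hB)
    (Z : FrobenioidCyclotomes (EnvOfFrobenioid.ofBiTheta 𝔉 h1 h3 hsec hcs h8 DK h218ii A hη i F Fr))
    (a : Z.intS.carrier ≃* 𝔉.lDeltaModN 𝔉.BN) (b : Z.muN ≃* 𝔉.muTorsion 𝔉.BN 𝔉.N)
    (hb : ∀ x, b (Z.corrExt x) = corrExtOfBiTheta 𝔉 h1 h3 hsec hcs h8 DK h218ii A hη i F Fr ι hi x)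
    (ha : ∀ (y : 𝔉.PiYdd) (hy : ι (y : 𝔉.PiX) ∈ R.lDeltaTheta)
      (hh : ((𝔉.rhoYdd y : 𝔉.HB) : Aut (𝔉.base.obj 𝔉.BN)) ∈ P.pre (𝔉.base.obj 𝔉.BN)),
      a (Z.corrInt (((ModelCyclotomes.intCycEquiv R).symm
        ((⟨ι (y : 𝔉.PiX), hy⟩ : R.lDeltaTheta) : ModelCyclotomes.lDeltaQuot R) :
          (ModelCyclotomes.intCyc R).carrier) : ModPow (ModelCyclotomes.intCyc R).carrier (S.N : ℕ))) =
        (QuotientGroup.mk (P.proj _ ⟨_, hh⟩) : 𝔉.lDeltaModN 𝔉.BN))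
    (hcov : ∀ x : 𝔉.lDeltaModN 𝔉.BN, ∃ (y : 𝔉.PiYdd) (_ : ι (y : 𝔉.PiX) ∈ R.lDeltaTheta)
      (hh : ((𝔉.rhoYdd y : 𝔉.HB) : Aut (𝔉.base.obj 𝔉.BN)) ∈ P.pre (𝔉.base.obj 𝔉.BN)),
      (QuotientGroup.mk (P.proj _ ⟨_, hh⟩) : 𝔉.lDeltaModN 𝔉.BN) = x) :
    𝔉.CycRigidityCoincide
      (a.symm.trans ((Z.monoTheta
        (F.cyclotomicRigidity (isoModelOfBiTheta 𝔉 h1 h3 hsec hcs h8 DK h218ii A hη i).e)).trans b)) ρ hB := by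
  apply MulEquiv.ext
  intro x
  obtain ⟨y, hy, hh, rfl⟩ := hcov x
  rw [MulEquiv.trans_apply, MulEquiv.trans_apply]
  exact (monoTheta_read_eq_rigidity_ofBiTheta 𝔉 h1 h3 hsec hcs h8 DK h218ii A hη i F Fr ι hi hYdd P ρ hB hρ Z a b
    hb ha y hy hh).symm

/-- **[IUTchII] Prop. 1.3 (iii) at the GENUINE `M^Θ(𝒞) = E^Π_N`** (over the interface INSTANCE of the §5 data,
abc-iut-w5-d177's `TemperedFrobenioidData.ofThetaFrobenioid S 𝔉 e`, so that `𝒞` of the interface IS `𝒞` of `𝔉` as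
p411824's reduction requires) — abc-iut-L6-t1's `Prop13_iii C₀ Z B` for the genuine Def. 1.1 (ii) isomorphism `C₀` and
any `Z` as above, any [AbsTopIII] comparison data `B` — **is EQUIVALENT to the
single equation "`(*bs-Gal)` read in `𝒞`'s cyclotomes `= ρ_{B_N}`"** (plan/GAP-LEDGER G-w4d042-1: the [AbsTopIII] /
[FrdII] Thm. 2.4 (ii) compatibility the lead-in of Prop. 1.3 cites), with no [EtTh] hypothesis left except the
bi-theta isomorphism of Lemma 5.9 (iv) and Prop. 5.5 BY NAME (this seat's `prop13_iii_iff_bsGal_read_eq_rho` with its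
`h59v` supplied by `cycRigidityCoincide_monoTheta_ofBiTheta`).
[claim: Mochizuki2012, status: disputed] (IUTchII §1 Prop 1.3 (iii), kurims pp.26-27) -/
theorem prop13_iii_ofBiTheta_iff (e : D ≌ BTemp0 S.PiX) (ι : 𝔉.PiX ≃ₜ* R.PiX)
    (hi : ∀ x : 𝔉.EPiN, ((CycEnvelope.proj R.augY R.chi (i.e x) : R.PiY) : R.PiX) = ι (𝔉.toPiY x))
    (hYdd : 𝔉.PiYdd.map ι.toMonoidHom = R.PiYdd)
    (P : FrobenioidCyclotomicRigidity.ThetaSubquotientProj 𝔉) (ρ : FrobenioidCyclotomicRigidity.RigidityFamily 𝔉)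
    (hB : 𝔉.IsThetaSaturated 𝔉.BN) (hρ : FrobenioidCyclotomicRigidity.IsKummerDetermined 𝔉 P ρ hB)
    (Z : FrobenioidCyclotomes (EnvOfFrobenioid.ofBiTheta 𝔉 h1 h3 hsec hcs h8 DK h218ii A hη i F
      (TemperedFrobenioidData.ofThetaFrobenioid S 𝔉 e)))
    (a : Z.intS.carrier ≃* 𝔉.lDeltaModN 𝔉.BN) (b : Z.muN ≃* 𝔉.muTorsion 𝔉.BN 𝔉.N)
    (hb : ∀ x, b (Z.corrExt x) = corrExtOfBiTheta 𝔉 h1 h3 hsec hcs h8 DK h218ii A hη i F _ ι hi x)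
    (ha : ∀ (y : 𝔉.PiYdd) (hy : ι (y : 𝔉.PiX) ∈ R.lDeltaTheta)
      (hh : ((𝔉.rhoYdd y : 𝔉.HB) : Aut (𝔉.base.obj 𝔉.BN)) ∈ P.pre (𝔉.base.obj 𝔉.BN)),
      a (Z.corrInt (((ModelCyclotomes.intCycEquiv R).symm
        ((⟨ι (y : 𝔉.PiX), hy⟩ : R.lDeltaTheta) : ModelCyclotomes.lDeltaQuot R) :
          (ModelCyclotomes.intCyc R).carrier) : ModPow (ModelCyclotomes.intCyc R).carrier (S.N : ℕ))) =
        (QuotientGroup.mk (P.proj _ ⟨_, hh⟩) : 𝔉.lDeltaModN 𝔉.BN))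
    (hcov : ∀ x : 𝔉.lDeltaModN 𝔉.BN, ∃ (y : 𝔉.PiYdd) (_ : ι (y : 𝔉.PiX) ∈ R.lDeltaTheta)
      (hh : ((𝔉.rhoYdd y : 𝔉.HB) : Aut (𝔉.base.obj 𝔉.BN)) ∈ P.pre (𝔉.base.obj 𝔉.BN)),
      (QuotientGroup.mk (P.proj _ ⟨_, hh⟩) : 𝔉.lDeltaModN 𝔉.BN) = x) (B : BsGalData Z) :
    Prop13_iii (F.cyclotomicRigidity (isoModelOfBiTheta 𝔉 h1 h3 hsec hcs h8 DK h218ii A hη i).e) Z B ↔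
      ∀ x, b (B.bsGal x) = ρ 𝔉.BN hB (a x) :=
  prop13_iii_iff_bsGal_read_eq_rho 𝔉 hB ρ _ Z B a b
    (cycRigidityCoincide_monoTheta_ofBiTheta 𝔉 h1 h3 hsec hcs h8 DK h218ii A hη i F _ ι hi hYdd P ρ hB hρ Z a b hb
      ha hcov)

/-- **[IUTchII] Prop. 1.3 (iii) at the genuine `M^Θ(𝒞)`, closing direction**: the equation of G-w4d042-1 implies
`Prop13_iii`. [claim: Mochizuki2012, status: disputed] (IUTchII §1 Prop 1.3 (iii), kurims pp.26-27) -/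
theorem prop13_iii_ofBiTheta_of_bsGal (e : D ≌ BTemp0 S.PiX) (ι : 𝔉.PiX ≃ₜ* R.PiX)
    (hi : ∀ x : 𝔉.EPiN, ((CycEnvelope.proj R.augY R.chi (i.e x) : R.PiY) : R.PiX) = ι (𝔉.toPiY x))
    (hYdd : 𝔉.PiYdd.map ι.toMonoidHom = R.PiYdd)
    (P : FrobenioidCyclotomicRigidity.ThetaSubquotientProj 𝔉) (ρ : FrobenioidCyclotomicRigidity.RigidityFamily 𝔉)
    (hB : 𝔉.IsThetaSaturated 𝔉.BN) (hρ : FrobenioidCyclotomicRigidity.IsKummerDetermined 𝔉 P ρ hB)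
    (Z : FrobenioidCyclotomes (EnvOfFrobenioid.ofBiTheta 𝔉 h1 h3 hsec hcs h8 DK h218ii A hη i F
      (TemperedFrobenioidData.ofThetaFrobenioid S 𝔉 e)))
    (a : Z.intS.carrier ≃* 𝔉.lDeltaModN 𝔉.BN) (b : Z.muN ≃* 𝔉.muTorsion 𝔉.BN 𝔉.N)
    (hb : ∀ x, b (Z.corrExt x) = corrExtOfBiTheta 𝔉 h1 h3 hsec hcs h8 DK h218ii A hη i F _ ι hi x)
    (ha : ∀ (y : 𝔉.PiYdd) (hy : ι (y : 𝔉.PiX) ∈ R.lDeltaTheta)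
      (hh : ((𝔉.rhoYdd y : 𝔉.HB) : Aut (𝔉.base.obj 𝔉.BN)) ∈ P.pre (𝔉.base.obj 𝔉.BN)),
      a (Z.corrInt (((ModelCyclotomes.intCycEquiv R).symm
        ((⟨ι (y : 𝔉.PiX), hy⟩ : R.lDeltaTheta) : ModelCyclotomes.lDeltaQuot R) :
          (ModelCyclotomes.intCyc R).carrier) : ModPow (ModelCyclotomes.intCyc R).carrier (S.N : ℕ))) =
        (QuotientGroup.mk (P.proj _ ⟨_, hh⟩) : 𝔉.lDeltaModN 𝔉.BN))
    (hcov : ∀ x : 𝔉.lDeltaModN 𝔉.BN, ∃ (y : 𝔉.PiYdd) (_ : ι (y : 𝔉.PiX) ∈ R.lDeltaTheta)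
      (hh : ((𝔉.rhoYdd y : 𝔉.HB) : Aut (𝔉.base.obj 𝔉.BN)) ∈ P.pre (𝔉.base.obj 𝔉.BN)),
      (QuotientGroup.mk (P.proj _ ⟨_, hh⟩) : 𝔉.lDeltaModN 𝔉.BN) = x) (B : BsGalData Z) (hgal : ∀ x, b (B.bsGal x) = ρ 𝔉.BN hB (a x)) :
    Prop13_iii (F.cyclotomicRigidity (isoModelOfBiTheta 𝔉 h1 h3 hsec hcs h8 DK h218ii A hη i).e) Z B :=
  (prop13_iii_ofBiTheta_iff 𝔉 h1 h3 hsec hcs h8 DK h218ii A hη i F e ι hi hYdd P ρ hB hρ Z a b hb ha hcov B).mpr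
    hgal

end GenuineCoincide

end Literature.IUT.HodgeArakelov

end
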